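import Summits.CriticalPhenomena.SAWScalingLimit.Theses.SAWDevelopingMap
import Summits.CriticalPhenomena.SAWScalingLimit.Theorems.ObservableToSLE.Negative.Identification
import Literature.Probability.Percolation.CLE6Proofs
import Literature.Probability.RandomPlanarGeometry.ConformalRestrictionProofs
import Mathlib.MeasureTheory.Measure.Portmanteau

/-!
# Crux `SAWDevelopingMap.ObservableToSLE` (stmt-CriticalPhenomena-10472), line
`floor-ratio-restriction-bootstrap`, stub `stub_restrictionIdentifies`: the portmanteau sandwich

Landing target:
`Summits/CriticalPhenomena/SAWScalingLimit/Theorems/SAWDevelopingMapObservableToSLERestrictionIdentifiesSandwich.lean`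
(`--supports stmt-CriticalPhenomena-10472`).

The registered stub `stub_restrictionIdentifies` (LSW closing) assumes, for every hull subdomain
`D'` of the Dobrushin domain `D`, that the `hexSAWLaw`-probability of the LATTICE event
`E_δ(D') = {all vertices of the walk in D', all edge segments in cl D'}` tends to `d^{5/8}` as the
mesh `δ → 0⁺`, and asks to identify every subsequential limit law `μ` of the SAW curves.  This file
proves the first, purely lattice/weak-convergence step (no conformal map enters):

* `curve_range_subset`, `mem_curve_range`, `segment_subset_curve_range` — the trace of the polyline
  of a SAW is controlled by (and contains) its vertices and edge segments;
* `meshEvent_subset` — `E_δ(D') ⊆ {curve ⊆ cl D'}` (a CLOSED event of the curve space);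
* `rangeSubset_compl_subset_meshEvent` — for a closed `S` with `D ∖ D' ⊆ S` and `cl D ∖ S ⊆ cl D'`
  and distinct endpoints, `{curve ∩ S = ∅} ⊆ E_δ(D')` (an OPEN event of the curve space);
* `exists_seq_portmanteau` — a subsequential limit law of the SAW curves (`IsSubseqLimitLaw`) is a
  weak limit of probability measures along meshes `s n → 0⁺`, whence the two portmanteau
  inequalities (Mathlib `ProbabilityMeasure.limsup_measure_closed_le_of_tendsto`,
  `ProbabilityMeasure.le_liminf_measure_open_of_tendsto`);
* `stub_restrictionIdentifies_sandwich` — **the sandwich**: if `P_δ(E_δ(D')) → p` then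
  `μ {curve ∩ S = ∅} ≤ p ≤ μ {curve ⊆ cl D'}`.

With `S = φ̂(A)` the image of the pulled-back hull `A = cl(ℍ ∖ φ⁻¹ D')` under the boundary extension
of a chordal uniformizing map, the left event is "the pulled-back trace avoids `A`" and the right
event is "the pulled-back trace stays in `cl(ℍ ∖ A)`"; the sibling file
`…RestrictionIdentifiesTransfer` turns the sandwich into the identification of `μ`.
-/

noncomputable section

open scoped BigOperators Topology NNReal ENNReal Classical
open Filter Set MeasureTheory Metric
open Literature.Probability.LatticeModels (HexVertex hexGraph hexCenter)
open Literature.Probability.RandomPlanarGeometry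
open Literature.Probability.RandomPlanarGeometry.SAW
open UpperHalfPlane (upperHalfPlaneSet)

namespace Summit.CriticalPhenomena.SAWScalingLimit.Theorems.ObservableToSLE.FloorRatio

open Summit.CriticalPhenomena.SAWScalingLimit.Theorems.ObservableToSLE.Negative
  (eventually_isProbabilityMeasure_hexSAWLaw mem_embMeshDomain_of_mem_support_tail)

/-! ### The trace of the polyline of a SAW -/

section Trace

variable {V : Type*} {G : SimpleGraph V} {emb : V → ℂ} {Ω : Set ℂ} {δ : ℝ} {a b : V}

/-- The trace of the curve of a SAW is the trace of its polyline. [folklore] -/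
theorem curve_range_eq (γ : EmbDomainSAW G emb Ω δ a b) :
    γ.curve.range = Set.range (γ.walk.toCurve fun v => (δ : ℂ) * emb v) := rfl

/-- **The trace is controlled by the vertices and edge segments**: if `S` contains the first
embedded vertex and the segment of every dart of the walk, the trace lies in `S`. [folklore] -/
theorem curve_range_subset (γ : EmbDomainSAW G emb Ω δ a b) {S : Set ℂ} (ha : (δ : ℂ) * emb a ∈ S)
    (hd : ∀ d ∈ γ.walk.darts, segment ℝ ((δ : ℂ) * emb d.fst) ((δ : ℂ) * emb d.snd) ⊆ S) :
    γ.curve.range ⊆ S := by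
  rw [curve_range_eq]
  exact SimpleGraph.Walk.range_toCurve_subset γ.walk ha hd

/-- Every embedded vertex of the walk lies on the trace. [folklore] -/
theorem mem_curve_range (γ : EmbDomainSAW G emb Ω δ a b) {v : V} (hv : v ∈ γ.walk.support) :
    (δ : ℂ) * emb v ∈ γ.curve.range := by
  rw [curve_range_eq]
  exact SimpleGraph.Walk.mem_range_toCurve _ _ hv

/-- Every edge segment of a walk lies on the trace of its polyline. [folklore] -/
theorem segment_subset_range_toCurve (f : V → ℂ) :
    ∀ {u v : V} (p : G.Walk u v), ∀ d ∈ p.darts,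
      segment ℝ (f d.fst) (f d.snd) ⊆ Set.range (p.toCurve f)
  | _, _, SimpleGraph.Walk.nil, d, hd => by simp at hd
  | _, _, SimpleGraph.Walk.cons h p, d, hd => by
    rw [SimpleGraph.Walk.range_toCurve_cons]
    rw [SimpleGraph.Walk.darts_cons, List.mem_cons] at hd
    rcases hd with rfl | hd
    · exact subset_union_left
    · exact (segment_subset_range_toCurve f p d hd).trans subset_union_right

/-- Every edge segment of the walk lies on the trace. [folklore] -/
theorem segment_subset_curve_range (γ : EmbDomainSAW G emb Ω δ a b)
    {d : (embDomainGraph G emb Ω δ).Dart} (hd : d ∈ γ.walk.darts) :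
    segment ℝ ((δ : ℂ) * emb d.fst) ((δ : ℂ) * emb d.snd) ⊆ γ.curve.range := by
  rw [curve_range_eq]
  exact segment_subset_range_toCurve (fun v => (δ : ℂ) * emb v) γ.walk d hd

/-- Every vertex of a non-trivial walk of `Ω_δ` lies in the discrete domain `Ω_δ`. [folklore] -/
theorem mem_embMeshDomain_of_mem_support {u v : V} (p : (embDomainGraph G emb Ω δ).Walk u v)
    (hp : ¬ p.Nil) {w : V} (hw : w ∈ p.support) : w ∈ embMeshDomain G emb Ω δ := by
  cases p with
  | nil => exact absurd SimpleGraph.Walk.nil_nil hp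
  | cons h q =>
    rw [SimpleGraph.Walk.support_cons, List.mem_cons] at hw
    rcases hw with rfl | hw
    · exact ((embDomainGraph_adj_iff G emb).1 h).2.1
    · exact mem_embMeshDomain_of_mem_support_tail (SimpleGraph.Walk.cons h q)
        (by rw [SimpleGraph.Walk.support_cons, List.tail_cons]; exact hw)

end Trace

/-! ### The lattice event and the two events of the curve space -/

section Events

variable {D D' : DobrushinDomain} {δ : ℝ} {a b : HexVertex}

/-- **`E_δ(D') ⊆ {curve ⊆ cl D'}`**: a walk with all vertices in `D'` and all edge segments in
`cl D'` has its polyline in the closed set `cl D'`. [folklore] -/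
theorem meshEvent_subset :
    {γ : HexDomainSAW D.carrier δ a b |
        (∀ v ∈ γ.walk.support, v ∈ embMeshVertices hexCenter D'.carrier δ) ∧
        ∀ e ∈ γ.walk.darts, (embMeshGraph hexGraph hexCenter D'.carrier δ).Adj e.fst e.snd} ⊆
      (fun γ : HexDomainSAW D.carrier δ a b => γ.curve) ⁻¹'
        CurveClass.rangeSubset (closure D'.carrier) := by
  rintro γ ⟨hv, he⟩
  rw [mem_preimage, CurveClass.mem_rangeSubset]
  refine curve_range_subset γ (subset_closure ?_) fun d hd => ((embMeshGraph_adj_iff _ _).1 (he d hd)).2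
  exact (mem_embMeshVertices_iff _).1 (hv _ γ.walk.start_mem_support)

/-- **`{curve ∩ S = ∅} ⊆ E_δ(D')`** for walks between DISTINCT endpoints, whenever the closed set `S`
contains `D ∖ D'` and `cl D ∖ S ⊆ cl D'`: every vertex of a non-trivial walk of `D_δ` is a point
of `D` on the trace, hence in `D ∖ S ⊆ D'`, and every edge segment lies on the trace and in
`cl D`, hence in `cl D ∖ S ⊆ cl D'`. [folklore] -/
theorem rangeSubset_compl_subset_meshEvent (hab : a ≠ b) {S : Set ℂ}
    (h1 : D.carrier \ D'.carrier ⊆ S) (h2 : closure D.carrier \ S ⊆ closure D'.carrier) :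
    (fun γ : HexDomainSAW D.carrier δ a b => γ.curve) ⁻¹' CurveClass.rangeSubset Sᶜ ⊆
      {γ : HexDomainSAW D.carrier δ a b |
        (∀ v ∈ γ.walk.support, v ∈ embMeshVertices hexCenter D'.carrier δ) ∧
        ∀ e ∈ γ.walk.darts, (embMeshGraph hexGraph hexCenter D'.carrier δ).Adj e.fst e.snd} := by
  intro γ hγ
  rw [mem_preimage, CurveClass.mem_rangeSubset] at hγ
  have hnil : ¬ γ.walk.Nil := by
    intro h
    exact hab h.eq
  refine ⟨fun v hv => ?_, fun e he => ?_⟩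
  · have hvD : (δ : ℂ) * hexCenter v ∈ D.carrier :=
      (mem_embMeshVertices_iff _).1
        (embMeshDomain_subset _ _ _ _ (mem_embMeshDomain_of_mem_support γ.walk hnil hv))
    have hvS : (δ : ℂ) * hexCenter v ∉ S := hγ (mem_curve_range γ hv)
    rw [mem_embMeshVertices_iff]
    by_contra hvD'
    exact hvS (h1 ⟨hvD, hvD'⟩)
  · have hadj : (embDomainGraph hexGraph hexCenter D.carrier δ).Adj e.fst e.snd := e.adj
    have hadj' : (embMeshGraph hexGraph hexCenter D.carrier δ).Adj e.fst e.snd :=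
      ((embDomainGraph_adj_iff hexGraph hexCenter).1 hadj).1
    have hG : hexGraph.Adj e.fst e.snd := ((embMeshGraph_adj_iff hexGraph hexCenter).1 hadj').1
    have hseg : segment ℝ ((δ : ℂ) * hexCenter e.fst) ((δ : ℂ) * hexCenter e.snd) ⊆
        closure D.carrier := ((embMeshGraph_adj_iff hexGraph hexCenter).1 hadj').2
    have hsegr : segment ℝ ((δ : ℂ) * hexCenter e.fst) ((δ : ℂ) * hexCenter e.snd) ⊆
        γ.curve.range := segment_subset_curve_range γ he
    exact (embMeshGraph_adj_iff hexGraph hexCenter).2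
      ⟨hG, fun z hz => h2 ⟨hseg hz, hγ (hsegr hz)⟩⟩

end Events

/-! ### Portmanteau along the meshes of a subsequential limit law -/

section Portmanteau

variable {D : DobrushinDomain} {a b : ℝ → HexVertex} {μ : Measure (CurveClass ℂ)}

/-- **Portmanteau for subsequential limit laws of the SAW curves.** If `μ` is a subsequential
limit law (`IsSubseqLimitLaw`) of the curves of `hexSAWLaw D δ (a δ) (b δ)` and the endpoints
approximate the marked points, then along some sequence of meshes `s n → 0⁺` the push-forward laws
are eventually probability measures converging weakly to `μ`, so that for every closed `F`,
`limsup P_{s n}(curve ∈ F) ≤ μ F`, and for every open `G`, `μ G ≤ liminf P_{s n}(curve ∈ G)`.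
[cite: BillingsleyCPM1999, Thm. 2.1 (portmanteau)] -/
theorem exists_seq_portmanteau (hab : IsEmbEndpointApprox hexGraph hexCenter D a b)
    [IsProbabilityMeasure μ]
    (hμ : IsSubseqLimitLaw (fun δ (γ : HexDomainSAW D.carrier δ (a δ) (b δ)) => γ.curve)
      (fun δ => hexSAWLaw D.carrier δ (a δ) (b δ)) μ) :
    ∃ s : ℕ → ℝ, Tendsto s atTop (𝓝[>] (0 : ℝ)) ∧
      (∀ F : Set (CurveClass ℂ), IsClosed F →
        limsup (fun n => hexSAWLaw D.carrier (s n) (a (s n)) (b (s n))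
          ((fun γ : HexDomainSAW D.carrier (s n) (a (s n)) (b (s n)) => γ.curve) ⁻¹' F)) atTop ≤
          μ F) ∧
      ∀ G : Set (CurveClass ℂ), IsOpen G →
        μ G ≤ liminf (fun n => hexSAWLaw D.carrier (s n) (a (s n)) (b (s n))
          ((fun γ : HexDomainSAW D.carrier (s n) (a (s n)) (b (s n)) => γ.curve) ⁻¹' G)) atTop := by
  classical
  obtain ⟨s, hs, hlim⟩ := hμ
  have hmeas : ∀ δ, Measurable (fun γ : HexDomainSAW D.carrier δ (a δ) (b δ) => γ.curve) :=
    fun δ => EmbDomainSAW.measurable_of_top _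
  -- the push-forward laws, padded to probability measures
  let Q : ℕ → Measure (CurveClass ℂ) := fun n =>
    (hexSAWLaw D.carrier (s n) (a (s n)) (b (s n))).map
      fun γ : HexDomainSAW D.carrier (s n) (a (s n)) (b (s n)) => γ.curve
  let c₀ : CurveClass ℂ := CurveClass.mk ⟨ContinuousMap.const _ 0⟩
  let Q' : ℕ → Measure (CurveClass ℂ) := fun n =>
    if IsProbabilityMeasure (Q n) then Q n else Measure.dirac c₀
  have hQ' : ∀ n, IsProbabilityMeasure (Q' n) := fun n => by
    by_cases h : IsProbabilityMeasure (Q n)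
    · simp only [Q', if_pos h]; exact h
    · simp only [Q', if_neg h]; infer_instance
  have hev : ∀ᶠ n in atTop, Q' n = Q n := by
    filter_upwards [hs.eventually (eventually_isProbabilityMeasure_hexSAWLaw hab)] with n hn
    have : IsProbabilityMeasure (Q n) := Measure.isProbabilityMeasure_map (hmeas _).aemeasurable
    simp only [Q', if_pos this]
  let P : ℕ → ProbabilityMeasure (CurveClass ℂ) := fun n => ⟨Q' n, hQ' n⟩
  have hP : Tendsto P atTop (𝓝 (⟨μ, inferInstance⟩ : ProbabilityMeasure (CurveClass ℂ))) := by
    rw [ProbabilityMeasure.tendsto_iff_forall_integral_tendsto]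
    intro f
    refine (hlim f).congr' ?_
    filter_upwards [hev] with n hn
    change ∫ ω, f ω.curve ∂hexSAWLaw D.carrier (s n) (a (s n)) (b (s n)) = ∫ x, f x ∂Q' n
    rw [hn]
    exact (integral_map (hmeas _).aemeasurable f.continuous.aestronglyMeasurable).symm
  have hPQ : ∀ᶠ n in atTop, ∀ T : Set (CurveClass ℂ), MeasurableSet T →
      ((P n : ProbabilityMeasure (CurveClass ℂ)) : Measure (CurveClass ℂ)) T =
        hexSAWLaw D.carrier (s n) (a (s n)) (b (s n))
          ((fun γ : HexDomainSAW D.carrier (s n) (a (s n)) (b (s n)) => γ.curve) ⁻¹' T) := by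
    filter_upwards [hev] with n hn T hT
    change Q' n T = _
    rw [hn]
    exact Measure.map_apply (hmeas _) hT
  refine ⟨s, hs, fun F hF => ?_, fun G hG => ?_⟩
  · have h := ProbabilityMeasure.limsup_measure_closed_le_of_tendsto hP hF
    refine le_trans (le_of_eq (limsup_congr ?_)) h
    filter_upwards [hPQ] with n hn
    exact (hn F hF.measurableSet).symm
  · have h := ProbabilityMeasure.le_liminf_measure_open_of_tendsto hP hG
    refine h.trans (le_of_eq (liminf_congr ?_))
    filter_upwards [hPQ] with n hn
    exact hn G hG.measurableSet

/-- Under an endpoint approximation the two lattice endpoints are eventually distinct (they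
converge to the two distinct marked points). [folklore] -/
theorem eventually_ne_of_isEmbEndpointApprox (hab : IsEmbEndpointApprox hexGraph hexCenter D a b) :
    ∀ᶠ δ in 𝓝[>] (0 : ℝ), a δ ≠ b δ := by
  have hne : D.pt 0 ≠ D.pt 1 := fun h => absurd (D.pt_injective h) (by decide)
  obtain ⟨U, V, hU, hV, hU0, hV1, hUV⟩ := t2_separation hne
  filter_upwards [hab.tendsto_fst (hU.mem_nhds hU0), hab.tendsto_snd (hV.mem_nhds hV1)]
    with δ h0 h1 heq
  have h0' : (δ : ℂ) * hexCenter (a δ) ∈ U := h0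
  have h1' : (δ : ℂ) * hexCenter (b δ) ∈ V := h1
  rw [heq] at h0'
  exact Set.disjoint_left.1 hUV h0' h1'

end Portmanteau

/-! ### The sandwich -/

/-- **The portmanteau sandwich** (named-binder form of `stub_restrictionIdentifies_sandwich`).  Let
`μ` be a probability subsequential limit law of the curves of the critical hexagonal SAW in
`(D; a, b)` and let `D'` be any Dobrushin domain for which the `hexSAWLaw`-probability of the lattice
event `E_δ(D') = {all vertices in D', all edge segments in cl D'}` tends to `p` as `δ → 0⁺`.  Then
for every closed `S ⊇ D ∖ D'` with `cl D ∖ S ⊆ cl D'`,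
`μ {curve ∩ S = ∅} ≤ p ≤ μ {curve ⊆ cl D'}`: the closed event `{curve ⊆ cl D'}` contains
`E_δ(D')` (`meshEvent_subset`), the open event `{curve ∩ S = ∅}` is contained in it
(`rangeSubset_compl_subset_meshEvent`, the endpoints being eventually distinct), and the two
portmanteau inequalities hold along the meshes of the subsequential limit
(`exists_seq_portmanteau`). [cite: BillingsleyCPM1999, Thm. 2.1 (portmanteau)] -/
theorem sandwich {D : DobrushinDomain} {a b : ℝ → HexVertex} {μ : Measure (CurveClass ℂ)}
    (hab : IsEmbEndpointApprox hexGraph hexCenter D a b) [IsProbabilityMeasure μ]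
    (hμ : IsSubseqLimitLaw (fun δ (γ : HexDomainSAW D.carrier δ (a δ) (b δ)) => γ.curve)
      (fun δ => hexSAWLaw D.carrier δ (a δ) (b δ)) μ)
    {D' : DobrushinDomain} {S : Set ℂ} (hS : IsClosed S) (h1 : D.carrier \ D'.carrier ⊆ S)
    (h2 : closure D.carrier \ S ⊆ closure D'.carrier) {p : ℝ≥0∞}
    (hp : Tendsto (fun δ : ℝ => (hexSAWLaw D.carrier δ (a δ) (b δ))
      {γ | (∀ v ∈ γ.walk.support, v ∈ embMeshVertices hexCenter D'.carrier δ) ∧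
        ∀ e ∈ γ.walk.darts, (embMeshGraph hexGraph hexCenter D'.carrier δ).Adj e.fst e.snd})
      (𝓝[>] 0) (𝓝 p)) :
    μ (CurveClass.rangeSubset Sᶜ) ≤ p ∧ p ≤ μ (CurveClass.rangeSubset (closure D'.carrier)) := by
  obtain ⟨s, hs, hclosed, hopen⟩ := exists_seq_portmanteau hab hμ
  have hps := hp.comp hs
  have hne : ∀ᶠ n in atTop, a (s n) ≠ b (s n) := hs.eventually (eventually_ne_of_isEmbEndpointApprox hab)
  constructor
  · refine (hopen _ (CurveClass.isOpen_rangeSubset hS.isOpen_compl)).trans ?_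
    rw [← hps.liminf_eq]
    refine liminf_le_liminf ?_
    filter_upwards [hne] with n hn
    exact measure_mono (rangeSubset_compl_subset_meshEvent hn h1 h2)
  · refine le_trans ?_ (hclosed _ (CurveClass.isClosed_rangeSubset isClosed_closure))
    rw [← hps.limsup_eq]
    refine limsup_le_limsup ?_
    filter_upwards with n
    exact measure_mono meshEvent_subset

/-- **Registered sub-goal `stub_restrictionIdentifies_sandwich`** (crux item
stmt-CriticalPhenomena-10472, line `floor-ratio-restriction-bootstrap`, stub
`stub_restrictionIdentifies`, step (i) of its docstring): THE PORTMANTEAU SANDWICH, registered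
one-line form of `sandwich` — for a probability subsequential limit law `μ` of the SAW curves, any
Dobrushin domain `D'` with `P_δ(E_δ(D')) → p`, and any closed `S ⊇ D ∖ D'` with `cl D ∖ S ⊆ cl D'`:
`μ {curve ∩ S = ∅} ≤ p ≤ μ {curve ⊆ cl D'}`. [cite: BillingsleyCPM1999, Thm. 2.1 (portmanteau)] -/
theorem stub_restrictionIdentifies_sandwich :
    ∀ (D : DobrushinDomain) (a b : ℝ → HexVertex) (μ : Measure (CurveClass ℂ)),
    IsEmbEndpointApprox hexGraph hexCenter D a b → IsProbabilityMeasure μ →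
    IsSubseqLimitLaw (fun δ (γ : HexDomainSAW D.carrier δ (a δ) (b δ)) => γ.curve)
      (fun δ => hexSAWLaw D.carrier δ (a δ) (b δ)) μ →
    ∀ (D' : DobrushinDomain) (S : Set ℂ), IsClosed S → D.carrier \ D'.carrier ⊆ S →
    closure D.carrier \ S ⊆ closure D'.carrier → ∀ (p : ℝ≥0∞),
    Tendsto (fun δ : ℝ => (hexSAWLaw D.carrier δ (a δ) (b δ))
      {γ | (∀ v ∈ γ.walk.support, v ∈ embMeshVertices hexCenter D'.carrier δ) ∧
        ∀ e ∈ γ.walk.darts, (embMeshGraph hexGraph hexCenter D'.carrier δ).Adj e.fst e.snd})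
      (𝓝[>] 0) (𝓝 p) →
    μ (CurveClass.rangeSubset Sᶜ) ≤ p ∧ p ≤ μ (CurveClass.rangeSubset (closure D'.carrier)) := by
  intro D a b μ hab hμp hμ D' S hS h1 h2 p hp
  haveI := hμp
  exact sandwich hab hμ hS h1 h2 hp

end Summit.CriticalPhenomena.SAWScalingLimit.Theorems.ObservableToSLE.FloorRatio

end
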